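import Literature.Probability.Percolation.QuadCrossingDualDecoupling
import Literature.Probability.Percolation.QuadCrossingContinuityCaseThreeTame
import Literature.Probability.Percolation.QuadAlignedCaseTwo
import HarnessLib

/-!
# Lemma 6.1, case (3), for tame quads with margin-internal junctions (no chord–arc)

Topic `Probability/Percolation`.  Support for the gluing theorem (Schramm–Smirnov 2011, Thm 1.5 /
Prop 4.1, step (C)): the free-side perturbations met there (a closed beach replaced by its
`T`-discretisation inside a closed bay) are one-sided perturbations of condition (3) whose quads are
lattice-tame at the working mesh and whose margin carries, at every point `x` of the perturbed free
side `∂₃Q'`, a **margin-internal short junction** to `∂₃Q` (a path of diameter `≤ ρ` inside `[Q]`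
meeting `[Q']` only at `x`), but no chord–arc control of `∂₃Q'`.  This file adapts dkkmo's dual
pipeline (`QuadCrossingDualSeparatorArm.lean`, `QuadCrossingDualDecoupling.lean`,
`QuadCrossingContinuityCaseThreeTame.lean`) to these hypotheses, exactly as
`QuadAlignedCaseTwo.lean` did for case (2):

* `Charts.mem_annulusOpenCrossingOff_of_dual'` — the key inclusion with the strip exit set replaced
  by the junction at the landing point `y` of the cut dual crossing (the chart gap condition `hEm`
  holds because the junction meets `[Q']` only at `y`), and the chord–arc step replaced by the
  continuity choice of the landing parameter (the whole side arc from the wall point to `y` stays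
  within `ρ` of the wall point);
* `Charts.measureReal_dual_far_le'` — the decoupling over the bottom cluster;
* `measureReal_symmDiff_le_mul_of_isPerturbationThree_tame'` — the product-form estimate
  `P(⊞_Q Δ ⊞_{Q'}) ≤ 2 (C ρ / d₀(Q))^α · P(dual crossing of rot Q')` at a single mesh `δ' ≤ ρ/2`, under
  lattice tameness of `[Q]` (segments) and `[Q']` (pieces) at that mesh, margin-internal junctions on
  `∂₃`, and the cut `ζ`.

Everything is proved; no named fact is introduced.

## References

* O. Schramm, S. Smirnov, Ann. Probab. 39 (2011) 1768–1814, arXiv:1101.5820, Lemma 6.1 and its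
  proof, p. 23 (case (3) symmetric to case (2)). [SchrammSmirnov2011]
* G. Grimmett, *Percolation*, 2nd ed. (1999), §11.7 (RSW). [GrimmettPercolation1999]
-/

noncomputable section

open Set Metric Filter Function
open _root_.MeasureTheory _root_.Topology
open scoped ENNReal symmDiff unitInterval
open Literature.Probability.LatticeModels
open Literature.Topology.PlaneTopology

namespace Literature.Probability.Percolation

namespace SSContinuity

namespace Frame

variable (Φ : Frame) {D : Set ℂ} {Q Q' : QuadCrossing.Quad D} {ω : BondConfig (Site 2)}

variable {Φ} in
/-- **The fresh open arm of the dual exploration, with a margin-internal junction as exit set.**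
As `Charts.mem_annulusOpenCrossingOff_of_dual`, without the chord–arc hypothesis: the exit set is
the junction `α` at the landing point `y` (meeting `[Q']` only at `y`), and the side arc from the
wall point `x♭` to `y` stays within `ρ` of `x♭` by the choice of the landing parameter.  Radii
`2ρ + 4δ'` and `c₃/2 - 4ρ - δ'`. [cite: SchrammSmirnov2011, proof of Lemma 6.1, case (3) via case (2), eq. (6.2)] -/
theorem Charts.mem_annulusOpenCrossingOff_of_dual' (hΦ : Φ.Charts Q') (hb : Φ.b = 1)
    (hc : Φ.c = -1) (hd : Φ.d = 1) (hG : ∀ t : I, Φ.G ⟨1, 2 * (t : ℝ) - 1⟩ = Q' (1, t))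
    (hcar : Q'.carrier ⊆ Q.carrier) (h0 : Q'.side 0 = Q.side 0) (h1 : Q'.side 1 ⊆ Q.side 1)
    {ρ : ℝ} (hρ : 0 < ρ) (hρ0 : ρ < Q.sideDist 0)
    (hjoin' : ∀ x ∈ Q'.side 2, ∃ y ∈ Q.side 2, ∃ α : Path x y, range α ⊆ Q.carrier ∧
      Metric.diam (range α) ≤ ρ ∧ ∀ s : I, α s ∈ Q'.carrier → α s = x)
    (htame : ∀ a b : Site 2, (zdGraph 2).Adj a b →
      IsPreconnected (segment ℝ (meshPoint Φ.δ a) (meshPoint Φ.δ b) ∩ Q.carrier))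
    (htame' : ∀ p : Site 2 × Site 2, (zdGraph 2).Adj p.1 p.2 →
      IsPreconnected (Q'.piece Φ.δ p))
    {c₃ : ℝ} (hc₃ : 12 * ρ + 6 * Φ.δ < c₃)
    (hfar : ∀ t ∈ Q.side 3, ∀ p : Path (Q'.dualWallPt Φ.δ ω) t, range p ⊆ Q.carrier →
      c₃ ≤ Metric.diam (range p))
    (hdual : ∃ β : ℝ → ℂ, ContinuousOn β (Icc 0 1) ∧ MapsTo β (Icc 0 1) Q'.carrier ∧ β 0 ∈ Q'.side 0 ∧
      β 1 ∈ Q'.side 2 ∧ ∀ t ∈ Icc (0 : ℝ) 1, β t ∉ openEdgeUnion Φ.δ ω)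
    (hKop : ∃ Kset : Set ℂ, IsCompact Kset ∧ IsConnected Kset ∧ Kset ⊆ Q.carrier ∧
      Kset ⊆ openEdgeUnion Φ.δ ω ∧ (Kset ∩ Q.side 1).Nonempty ∧ (Kset ∩ Q.side 3).Nonempty) :
    ω ∈ annulusOpenCrossingOff (Q'.revealedB Φ.δ (Q'.bottomCluster Φ.δ ω)) (Q'.dualWallPt Φ.δ ω)
      Φ.δ (2 * ρ + 4 * Φ.δ) (c₃ / 2 - 4 * ρ - Φ.δ) := by
  have hδ : 0 < Φ.δ := Φ.hδ
  have hKρ0 : 0 ≤ ρ := hρ.le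
  set d : Set ℂ := Q'.bottomCluster Φ.δ ω with hd_def
  set S : Set (Sym2 (Site 2)) := Q'.revealedB Φ.δ d with hS_def
  set θC : ℝ := Q'.topContact Φ.δ ω with hθC
  have hθCI : θC ∈ Icc (0 : ℝ) 1 := QuadCrossing.Quad.topContact_mem_Icc
  set tC : I := ⟨θC, hθCI⟩ with htC
  set xb : ℂ := Q'.dualWallPt Φ.δ ω with hxb
  have hxbeq : xb = Q' (1, tC) := rfl
  -- Step 1: a dual crossing landing close to the wall point
  obtain ⟨η, hη, hηcont⟩ : ∃ η > 0, ∀ θ : I, dist θ tC < η → dist (Q' (1, θ)) xb < ρ := by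
    have hcont : Continuous fun θ : I => Q' (1, θ) :=
      Q'.continuous_toFun.comp (continuous_const.prodMk continuous_id)
    obtain ⟨η, hη, h⟩ := (Metric.continuousAt_iff.1 (hcont.continuousAt (x := tC))) ρ hρ
    exact ⟨η, hη, fun θ hθ => by rw [hxbeq]; exact h hθ⟩
  obtain ⟨β, hβc, hβQ, hβ0, hβ1, hβO, hβside⟩ :=
    QuadCrossing.Quad.exists_dualPath_landing_lt hδ htame' hdual hη
  -- Step 2: cut at the first visit of `∂₂Q'`
  set T : Set ℝ := {t | t ∈ Icc (0 : ℝ) 1 ∧ β t ∈ Q'.side 2} with hT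
  have hTc : IsClosed T := hβc.preimage_isClosed_of_isClosed isClosed_Icc (Q'.isCompact_side 2).isClosed
  have hT1 : (1 : ℝ) ∈ T := ⟨right_mem_Icc.2 zero_le_one, hβ1⟩
  have hTbdd : BddBelow T := ⟨0, fun t ht => ht.1.1⟩
  set tS : ℝ := sInf T with htS
  have htST : tS ∈ T := hTc.csInf_mem ⟨1, hT1⟩ hTbdd
  have htSI : tS ∈ Icc (0 : ℝ) 1 := htST.1
  have htS2 : β tS ∈ Q'.side 2 := htST.2
  have hbefore : ∀ t ∈ Icc (0 : ℝ) 1, t < tS → β t ∉ Q'.side 2 := fun t ht hlt h2 =>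
    absurd (csInf_le hTbdd ⟨ht, h2⟩) (not_le.2 hlt)
  have htS0 : 0 < tS := by
    rcases htSI.1.eq_or_lt with h | h
    · exfalso
      rw [← h] at htS2
      exact Set.disjoint_left.1 (Q'.disjoint_side_side_add_two 0) hβ0 htS2
    · exact h
  obtain ⟨hγc, hγ0, hγ1, hγmaps⟩ := QuadCrossing.exists_reparam hβc le_rfl htS0.le htSI.2
  set γ : ℝ → ℂ := fun t => β (0 + t * (tS - 0)) with hγ
  have hγI : ∀ t ∈ Icc (0 : ℝ) 1, 0 + t * (tS - 0) ∈ Icc (0 : ℝ) 1 := fun t ht =>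
    let h := hγmaps t ht; ⟨h.1, h.2.trans htSI.2⟩
  have hγQ : MapsTo γ (Icc 0 1) Q'.carrier := fun t ht => hβQ (hγI t ht)
  have hγO : ∀ t ∈ Icc (0 : ℝ) 1, γ t ∉ openEdgeUnion Φ.δ ω := fun t ht => hβO _ (hγI t ht)
  have hγ0side : γ 0 ∈ Q'.side 0 := by rw [hγ0]; exact hβ0
  have hγ12 : γ 1 ∈ Q'.side 2 := by rw [hγ1]; exact htS2
  have hfirst : ∀ t ∈ Ico (0 : ℝ) 1, γ t ∉ Q'.side 2 := fun t ht => by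
    refine hbefore _ (hγI t ⟨ht.1, ht.2.le⟩) ?_
    have : 0 + t * (tS - 0) = t * tS := by ring
    rw [this]
    nlinarith [ht.2, htS0]
  -- the landing point `y = Q'(1, θn)` with `θ_C ≤ θn < θ_C + η`
  set y : ℂ := γ 1 with hy
  obtain ⟨θn, hθn⟩ : ∃ θ : I, y = Q' (1, θ) := by
    obtain ⟨⟨s₀, θ⟩, hs, hsy⟩ := (show y ∈ Q' '' {z : I × I | z.1 = 1} from hγ12)
    simp only [mem_setOf_eq] at hs
    subst hs
    exact ⟨θ, hsy.symm⟩
  have hθCn : θC ≤ (θn : ℝ) :=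
    QuadCrossing.Quad.topContact_le_of_dualPath hδ htame' hγc hγQ hγ0side hγO hθn hfirst
  have hθnη : (θn : ℝ) < θC + η := hβside tS htSI θn (by rw [← hθn]; exact hγ1.symm)
  have hyx : dist y xb < ρ := by
    rw [hθn]
    refine hηcont θn ?_
    rw [Subtype.dist_eq, Real.dist_eq, abs_of_nonneg (by simp only [htC]; linarith)]
    simp only [htC]; linarith
  -- Step 3: chart data of the barrier `Γ = G⁻¹(γ)`
  set h : ℝ := 2 * (θn : ℝ) - 1 with hh
  have hhI : h ∈ Icc Φ.c Φ.d := by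
    rw [hc, hd, hh]; constructor <;> linarith [θn.2.1, θn.2.2]
  set yh : ℂ := ⟨Φ.b, h⟩ with hyh
  have hGy : Φ.G yh = y := by
    rw [hθn, ← hG θn, hyh]
    congr 1
    apply Complex.ext <;> simp [hb, hh]
  have hpreim : ∀ {w : ℂ}, w ∈ Q'.carrier → Φ.G.symm w ∈ Φ.rect := by
    intro w hw
    rw [hΦ.carrier] at hw
    obtain ⟨u, hu, rfl⟩ := hw
    rwa [Φ.G.symm_apply_apply]
  set Γ : Set ℂ := Φ.G.symm '' (γ '' Icc 0 1) with hΓ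
  have hGΓ : Φ.G '' Γ = γ '' Icc 0 1 := by
    rw [hΓ, ← image_comp]
    simp only [Function.comp_def, Homeomorph.apply_symm_apply, image_id']
  have hγimc : IsCompact (γ '' Icc 0 1) := isCompact_Icc.image_of_continuousOn hγc
  have hΓc : IsCompact Γ := hγimc.image Φ.G.symm.continuous
  have hΓpc : IsPreconnected Γ :=
    (isPreconnected_Icc.image _ hγc).image _ Φ.G.symm.continuous.continuousOn
  have hΓr : Γ ⊆ Φ.rect := by
    rintro _ ⟨z, ⟨t, ht, rfl⟩, rfl⟩
    exact hpreim (hγQ ht)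
  have hΓa : ∃ z ∈ Γ, z.re = Φ.a := by
    have h0' := hγ0side
    rw [hΦ.side0] at h0'
    obtain ⟨u, ⟨hur, hure⟩, hue⟩ := h0'
    refine ⟨u, ⟨γ 0, ⟨0, left_mem_Icc.2 zero_le_one, rfl⟩, ?_⟩, hure⟩
    rw [← hue, Φ.G.symm_apply_apply]
  have hyhΓ : yh ∈ Γ := ⟨y, ⟨1, right_mem_Icc.2 zero_le_one, rfl⟩, by
    rw [← hGy, Φ.G.symm_apply_apply]⟩
  have hΓb : ∃ z ∈ Γ, z.re = Φ.b := ⟨yh, hyhΓ, rfl⟩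
  have hΓtop : ∀ z ∈ Γ, z.re = Φ.b → z.im ≤ h := by
    rintro z ⟨_, ⟨t, ht, rfl⟩, rfl⟩ hzre
    have hzrect : Φ.G.symm (γ t) ∈ Φ.rect := hpreim (hγQ ht)
    have h2 : γ t ∈ Q'.side 2 := by
      rw [hΦ.side2]
      exact ⟨Φ.G.symm (γ t), ⟨hzrect, hzre⟩, Φ.G.apply_symm_apply _⟩
    have ht1 : t = 1 := by
      by_contra hne
      exact hfirst t ⟨ht.1, lt_of_le_of_ne ht.2 hne⟩ h2
    subst ht1
    have : Φ.G.symm (γ 1) = yh := by rw [← hy, ← hGy, Φ.G.symm_apply_apply]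
    rw [this]
  have hΓO : ∀ z ∈ Γ, Φ.G z ∉ openEdgeUnion Φ.δ ω := by
    rintro _ ⟨_, ⟨t, ht, rfl⟩, rfl⟩
    rw [Φ.G.apply_symm_apply]; exact hγO t ht
  -- Step 4: the exit set at `y`: the margin-internal junction
  have hy2' : y ∈ Q'.side 2 := hγ12
  obtain ⟨y₂, hy₂, α, hαQ, hαdiam, hαint⟩ := hjoin' y hy2'
  have hαx : ∀ s, dist (α s) y ≤ ρ := fun s =>
    (dist_le_diam_of_mem (isCompact_range α.continuous).isBounded ⟨s, rfl⟩ ⟨0, α.source⟩).trans hαdiam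
  have hα0 : ∀ s, α s ∉ Q'.side 0 := fun s hs => by
    rw [h0] at hs
    have := QuadCrossing.Quad.sideDist_le hs hy₂ (QuadCrossing.Quad.tailPath α s)
      ((QuadCrossing.Quad.range_tailPath α s).trans hαQ)
    have hle : Metric.diam (range (QuadCrossing.Quad.tailPath α s)) ≤ ρ :=
      (diam_mono (QuadCrossing.Quad.range_tailPath α s) (isCompact_range α.continuous).isBounded).trans
        hαdiam
    linarith
  set E : Set ℂ := range α with hE
  have hEc : IsCompact E := isCompact_range α.continuous
  have hEpc : IsPreconnected E := (isConnected_range α.continuous).isPreconnected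
  have hEQ : E ⊆ Q.carrier := hαQ
  have hxE : y ∈ E := ⟨0, α.source⟩
  have hE2 : (E ∩ Q.side 2).Nonempty := ⟨y₂, ⟨1, α.target⟩, hy₂⟩
  have hEjoin : ∀ e ∈ E, ∃ p : Path y e, range p ⊆ Q.carrier ∧ ∀ s, dist (p s) y ≤ ρ := by
    rintro e ⟨s, rfl⟩
    refine ⟨QuadCrossing.Quad.headPath α s, (QuadCrossing.Quad.range_headPath α s).trans hαQ,
      fun t => ?_⟩
    obtain ⟨t', ht'⟩ := QuadCrossing.Quad.range_headPath α s ⟨t, rfl⟩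
    rw [← ht']
    exact hαx t'
  have hAE : Φ.G '' {u | u ∈ Φ.rect ∧ u.re = Φ.b ∧ u.im ∈ Icc h h} ⊆ E := by
    rintro _ ⟨u, ⟨-, hure, huim⟩, rfl⟩
    have hu : u = yh := by
      apply Complex.ext
      · rw [hure]
      · exact le_antisymm huim.2 huim.1
    rw [hu, hGy]
    exact hxE
  have hEm : ∀ u ∈ Φ.rect, u.re = Φ.b → Φ.G u ∈ E → h ≤ u.im := by
    rintro u hurect hure ⟨s, hs⟩
    have hGu : Φ.G u ∈ Q'.carrier := by rw [hΦ.carrier]; exact ⟨u, hurect, rfl⟩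
    have hαs : α s = y := hαint s (hs ▸ hGu)
    have hu : u = yh := Φ.G.injective (hs.symm.trans (hαs.trans hGy.symm))
    rw [hu]
  have hE0 : E ∩ Q'.side 0 = ∅ := by
    ext z
    simp only [mem_inter_iff, mem_empty_iff_false, iff_false, not_and]
    rintro ⟨s, rfl⟩
    exact hα0 s
  have hEy : ∀ e ∈ E, dist e y ≤ ρ := fun e he => by
    obtain ⟨p, -, hp⟩ := hEjoin e he
    simpa [p.target] using hp 1
  have hEx : ∀ e ∈ E, dist e xb ≤ 2 * ρ := fun e he => by
    linarith [dist_triangle e y xb, hEy e he, hyx.le]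
  -- Step 5: the wall and the region below it
  set W : Set ℂ := Φ.G '' Γ ∪ E with hW
  set Mreg : Set ℂ := {z | z ∈ Q.carrier ∧ ∀ t ∈ Q.side 3, ∀ π : Path z t,
      range π ⊆ Q.carrier → (range π ∩ W).Nonempty} with hMreg
  have hLc : IsCompact (Φ.G '' Γ) := by rw [hGΓ]; exact hγimc
  have hWc : IsCompact W := hLc.union hEc
  have hWcl : IsClosed W := hWc.isClosed
  have hyL : y ∈ Φ.G '' Γ := by rw [hGΓ]; exact ⟨1, right_mem_Icc.2 zero_le_one, rfl⟩
  have hWpc : IsPreconnected W := by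
    rw [hW]
    refine IsPreconnected.union y hyL hxE ?_ hEpc
    rw [hGΓ]; exact isPreconnected_Icc.image _ hγc
  have hWQ : W ⊆ Q.carrier := by
    refine union_subset ?_ hEQ
    rw [hGΓ]; rintro _ ⟨t, ht, rfl⟩; exact hcar (hγQ ht)
  have hW0 : (W ∩ Q.side 0).Nonempty :=
    ⟨γ 0, Or.inl (by rw [hGΓ]; exact ⟨0, left_mem_Icc.2 zero_le_one, rfl⟩), h0 ▸ hγ0side⟩
  have hW2 : (W ∩ Q.side 2).Nonempty := hE2.mono (inter_subset_inter_left _ subset_union_right)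
  have hside1M := QuadCrossing.Quad.side_one_subset_below hWc hWpc hWQ hW0 hW2
  have hWO : ∀ z ∈ W, z ∈ openEdgeUnion Φ.δ ω → z ∈ E := by
    rintro z (⟨u, hu, rfl⟩ | hzE) hzO
    · exact absurd hzO (hΓO u hu)
    · exact hzE
  -- Step 6: the bottom cluster is below the wall
  have hdM : d ⊆ Mreg := by
    intro p hp
    obtain ⟨q₀, hq₀, hpq₀⟩ := mem_iUnion₂.1 hp
    obtain ⟨U, hUd, hUpc, ⟨bpt, hbU, hb1⟩, hq₀U⟩ :=
      QuadCrossing.Quad.exists_isPreconnected_of_reach htame' hq₀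
    have hUO : U ⊆ openEdgeUnion Φ.δ ω := fun z hz => (QuadCrossing.Quad.bottomCluster_subset (hUd hz)).1
    have hUQ' : U ⊆ Q'.carrier := fun z hz => (QuadCrossing.Quad.bottomCluster_subset (hUd hz)).2
    have hKc : IsCompact (closure U) :=
      Q'.isCompact_carrier.of_isClosed_subset isClosed_closure
        (Q'.isCompact_carrier.isClosed.closure_subset_iff.2 hUQ')
    have hKconn : IsConnected (closure U) := ⟨⟨bpt, subset_closure hbU⟩, hUpc.closure⟩
    have hKO : closure U ⊆ openEdgeUnion Φ.δ ω :=
      (isClosed_openEdgeUnion hδ ω).closure_subset_iff.2 hUO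
    have hKQ' : closure U ⊆ Q'.carrier := Q'.isCompact_carrier.isClosed.closure_subset_iff.2 hUQ'
    have hJ := joinedIn_inter_openEdgeUnion_of_isConnected hδ hKc hKconn hKO hKQ'
      (subset_closure hbU) (subset_closure (hq₀U hpq₀))
    set π₀ : Path bpt p := hJ.somePath with hπ₀
    have hπ₀mem : ∀ t, π₀ t ∈ Q'.carrier ∩ openEdgeUnion Φ.δ ω := hJ.somePath_mem
    -- in the chart: the base point is on the bottom side, off `Γ`, hence below `Γ`
    set bh : ℂ := Φ.G.symm bpt with hbh
    have hbhrect : bh ∈ Φ.rect := hpreim (hπ₀mem 0 |>.1 |> fun h => by simpa [π₀.source] using h)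
    have hb1' := hb1
    rw [hΦ.side1] at hb1'
    obtain ⟨u, ⟨hur, huim⟩, hue⟩ := hb1'
    have hbhu : bh = u := by rw [hbh, ← hue, Φ.G.symm_apply_apply]
    have hbhΓ : bh ∉ Γ := fun hmem => hΓO bh hmem (by
      rw [hbh, Φ.G.apply_symm_apply]; exact hUO hbU)
    have hbhbelow : bh ∈ Φ.belowSet Γ :=
      Φ.mem_belowSet_of_im_eq_c hΓr hbhrect (by rw [hbhu]; exact huim) hbhΓ
    -- the chart image of the open chain joins `bh` to `G⁻¹ p` off `Γ`
    set ph : ℂ := Φ.G.symm p with hph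
    have hJ' : JoinedIn (Φ.extRect \ Γ) bh ph := by
      refine ⟨(π₀.map Φ.G.symm.continuous).cast (by rw [hbh]) (by rw [hph]), fun t => ?_⟩
      rw [Path.cast_coe, Path.map_coe, Function.comp_apply]
      refine ⟨Φ.rect_subset_extRect (hpreim (hπ₀mem t).1), fun hmem => ?_⟩
      exact hΓO _ hmem (by rw [Φ.G.apply_symm_apply]; exact (hπ₀mem t).2)
    have hphbelow : ph ∈ Φ.belowSet Γ := Φ.mem_belowSet_of_joinedIn hbhbelow hJ'
    have hphrect : ph ∈ Φ.rect := hpreim (hUQ' (hq₀U hpq₀))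
    have := hΦ.image_subset_below_of_mem_belowSet hcar h0 h1 hΓc hΓpc hΓr hΓa hΓb hΓtop hEc hEQ
      hWpc hE2 hAE hEm hE0 hphbelow hphrect
    rwa [hph, Φ.G.apply_symm_apply] at this
  -- Step 7: the open transversal crossing as a path; its last time below the wall
  obtain ⟨Kset, hKsc, hKsconn, hKsQ, hKsO, ⟨a₁, ha₁K, ha₁⟩, ⟨a₃, ha₃K, ha₃⟩⟩ := hKop
  have hJκ := joinedIn_inter_openEdgeUnion_of_isConnected hδ hKsc hKsconn hKsO hKsQ ha₁K ha₃K
  set κ : Path a₁ a₃ := hJκ.somePath with hκ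
  have hκmem : ∀ t, κ t ∈ Q.carrier ∩ openEdgeUnion Φ.δ ω := hJκ.somePath_mem
  set f : ℝ → ℂ := fun s => κ.extend s with hf
  have hfc : ContinuousOn f (Icc 0 1) := κ.continuous_extend.continuousOn
  have hfmem : ∀ s, f s ∈ Q.carrier ∩ openEdgeUnion Φ.δ ω := fun s => hκmem _
  have hfQ : MapsTo f (Icc 0 1) Q.carrier := fun s _ => (hfmem s).1
  have hf0 : f 0 = a₁ := κ.extend_zero
  have hf1 : f 1 = a₃ := κ.extend_one
  have hf0M : f 0 ∈ Mreg := by rw [hf0]; exact hside1M ha₁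
  -- side arc from the wall point to the landing point, within `ρ` of `x♭` (choice of `η`)
  have harcx : ∀ u : I, (θC ≤ (u : ℝ) ∧ (u : ℝ) ≤ θn) → dist (Q' (1, u)) xb ≤ ρ := fun u hu => by
    refine (hηcont u ?_).le
    rw [Subtype.dist_eq, Real.dist_eq, abs_of_nonneg (by simp only [htC]; linarith [hu.1])]
    simp only [htC]; linarith [hu.2]
  -- paths from `x♭` through `y` and a point of `E` have small beginnings: the `∂₃Q` endpoint is off `W`
  have hpath_small : ∀ e ∈ E, ∃ p : Path xb e, range p ⊆ Q.carrier ∧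
      ∀ s, dist (p s) xb ≤ 2 * ρ := by
    intro e he
    obtain ⟨j, hjQ, hj⟩ := hEjoin e he
    set arc : Path xb y := (sideArc Q' tC θn).cast hxbeq hθn with harc'
    refine ⟨arc.trans j, ?_, fun s => ?_⟩
    · rw [Path.trans_range]
      refine union_subset ?_ hjQ
      rintro _ ⟨s, rfl⟩
      rw [harc', Path.cast_coe]
      obtain ⟨θ', hθ', -⟩ := range_sideArc_subset Q' tC θn ⟨s, rfl⟩
      rw [hθ']; exact hcar (Q'.side_subset_carrier 2 ⟨(1, θ'), rfl, rfl⟩)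
    · have : (arc.trans j) s ∈ range arc ∪ range j := by
        rw [← Path.trans_range]; exact ⟨s, rfl⟩
      rcases this with ⟨s', hs'⟩ | ⟨s', hs'⟩
      · rw [← hs', harc', Path.cast_coe]
        obtain ⟨θ', hθ', hbet⟩ := range_sideArc_subset Q' tC θn ⟨s', rfl⟩
        rw [hθ']
        have hb' : θC ≤ (θ' : ℝ) ∧ (θ' : ℝ) ≤ θn := by
          rcases hbet with hb' | hb'
          · exact ⟨hb'.1, hb'.2⟩
          · exact ⟨hθCn.trans hb'.1, by
              have : (θ' : ℝ) ≤ θC := hb'.2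
              linarith⟩
        linarith [harcx θ' hb']
      · rw [← hs']
        linarith [dist_triangle (j s') y xb, hj s', hyx.le]
  have ha₃W : a₃ ∉ W := by
    intro ha₃W
    have ha₃E : a₃ ∈ E := hWO a₃ ha₃W (hκmem 1 |>.2 |> fun h => by simpa [κ.target] using h)
    obtain ⟨p, hpQ, hp⟩ := hpath_small a₃ ha₃E
    have hdiam : Metric.diam (range p) ≤ 4 * ρ := by
      refine Metric.diam_le_of_forall_dist_le (by positivity) ?_
      rintro _ ⟨s, rfl⟩ _ ⟨s', rfl⟩
      linarith [dist_triangle (p s) xb (p s'), dist_comm xb (p s'), hp s, hp s']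
    have := hfar a₃ ha₃ p hpQ
    linarith
  have hf1M : f 1 ∉ Mreg := by
    rw [hf1]
    exact QuadCrossing.Quad.not_mem_below_of_path_avoiding ha₃ (Path.refl a₃)
      (by rintro _ ⟨s, rfl⟩; exact Q.side_subset_carrier 3 ha₃) (fun s => by simpa using ha₃W)
  obtain ⟨tσ, hσI, hσW, hafter⟩ :=
    QuadCrossing.Quad.exists_final_segment_avoiding_below hWcl hfc hfQ hf0M hf1M
  set e : ℂ := f tσ with he
  have heE : e ∈ E := hWO e hσW (hfmem tσ).2
  have hex : dist e xb ≤ 2 * ρ := hEx e heE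
  -- Step 8: the tail `g` of `κ` after `tσ`: off `M`, inside `O`, with a far point
  obtain ⟨hgc, hg0, hg1, hgmaps⟩ := QuadCrossing.exists_reparam hfc hσI.1 hσI.2.le le_rfl
  set g : ℝ → ℂ := fun t => f (tσ + t * (1 - tσ)) with hg
  have hgO : ∀ t, g t ∈ openEdgeUnion Φ.δ ω := fun t => (hfmem _).2
  have hgQ : ∀ t, g t ∈ Q.carrier := fun t => (hfmem _).1
  have hgout : ∀ t ∈ Ioc (0 : ℝ) 1, g t ∉ Mreg := fun t ht => by
    refine hafter (tσ + t * (1 - tσ)) ⟨?_, ?_⟩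
    · nlinarith [ht.1, hσI.2]
    · nlinarith [ht.2, hσI.1, hσI.2]
  have hg0x : dist (g 0) xb ≤ 2 * ρ := by rw [hg0]; exact hex
  -- the far point
  set R₀ : ℝ := c₃ / 2 - 4 * ρ with hR₀
  have hfarpt : ∃ t ∈ Icc (0 : ℝ) 1, R₀ ≤ dist (g t) xb := by
    obtain ⟨pg, hpg⟩ := QuadCrossing.exists_path_of_continuousOn hgc
    have hpgr : range pg ⊆ g '' Icc 0 1 := by
      rintro _ ⟨t, rfl⟩; exact ⟨t, t.2, (hpg t).symm⟩
    obtain ⟨j, hjQ, hj⟩ := hpath_small e heE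
    have he0 : e = g 0 := hg0.symm
    have ha₃1 : a₃ = g 1 := by rw [hg1, hf1]
    let big : Path xb a₃ := j.trans (pg.cast he0 ha₃1)
    have hbig_range : range big = range j ∪ range pg := by
      simp only [big, Path.trans_range, Path.cast_coe]
    have hbigQ : range big ⊆ Q.carrier := by
      rw [hbig_range]
      refine union_subset hjQ (hpgr.trans ?_)
      rintro _ ⟨t, -, rfl⟩; exact hgQ t
    have hd₁ : c₃ ≤ Metric.diam (range big) := hfar a₃ ha₃ big hbigQ
    have hdj : Metric.diam (range j) ≤ 4 * ρ := by
      refine Metric.diam_le_of_forall_dist_le (by positivity) ?_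
      rintro _ ⟨s, rfl⟩ _ ⟨s', rfl⟩
      linarith [dist_triangle (j s) xb (j s'), dist_comm xb (j s'), hj s, hj s']
    have hepg : e ∈ range j ∩ range pg := ⟨⟨1, j.target⟩, ⟨0, by rw [hpg]; exact hg0⟩⟩
    have hunion : Metric.diam (range big) ≤ 4 * ρ + Metric.diam (range pg) := by
      rw [hbig_range]
      have := Metric.diam_union' ⟨e, hepg⟩; linarith
    have hpgd : c₃ - 4 * ρ ≤ Metric.diam (range pg) := by linarith
    by_contra hcon
    push Not at hcon
    have hKpg : IsCompact (range pg) := isCompact_range pg.continuous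
    obtain ⟨m₀, hm₀, hmax⟩ := hKpg.exists_isMaxOn ⟨e, hepg.2⟩
      (continuous_id.dist continuous_const).continuousOn (f := fun z => dist z e)
    have hm₀lt : dist m₀ e < c₃ / 2 - 2 * ρ := by
      obtain ⟨t, ht, hteq⟩ := hpgr hm₀
      rw [← hteq]
      have h1 := hcon t ht
      linarith [dist_triangle (g t) xb e, dist_comm xb e, hex]
    have hbound : Metric.diam (range pg) ≤ 2 * dist m₀ e := by
      refine Metric.diam_le_of_forall_dist_le (by positivity) fun u hu v hv => ?_
      have hu' : dist u e ≤ dist m₀ e := hmax hu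
      have hv' : dist v e ≤ dist m₀ e := hmax hv
      linarith [dist_triangle u e v, dist_comm e v]
    linarith
  obtain ⟨t₁, ht₁, ht₁far⟩ := hfarpt
  -- Step 9: the arm: after the last visit of `B̄(x♭, r₁)`, until distance `R₀`
  set r₁ : ℝ := 2 * ρ + 3 * Φ.δ with hr₁
  have hr₁R : r₁ < R₀ := by rw [hr₁, hR₀]; linarith
  obtain ⟨hγ'c, hγ'0, hγ'1, hγ'maps⟩ := QuadCrossing.exists_reparam hgc le_rfl ht₁.1 ht₁.2
  set γ' : ℝ → ℂ := fun t => g (0 + t * (t₁ - 0)) with hγ'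
  have h0lt : dist (γ' 0) xb < r₁ := by rw [hγ'0]; linarith [hδ]
  have h1gt : r₁ < dist (γ' 1) xb := by rw [hγ'1]; linarith
  obtain ⟨u₀, hu₀, hu₀eq, hu₀after⟩ := QuadCrossing.exists_last_le
    (g := fun t => dist (γ' t) xb) ((continuous_id.dist continuous_const).comp_continuousOn hγ'c) h0lt h1gt
  obtain ⟨hγ₂c, hγ₂0, hγ₂1, hγ₂maps⟩ := QuadCrossing.exists_reparam hγ'c hu₀.1.le hu₀.2.le le_rfl
  set γ₂ : ℝ → ℂ := fun t => γ' (u₀ + t * (1 - u₀)) with hγ₂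
  have h0 : dist (γ₂ 0) xb < R₀ := by rw [hγ₂0, hu₀eq]; exact hr₁R
  have h1 : R₀ ≤ dist (γ₂ 1) xb := by rw [hγ₂1, hγ'1]; exact ht₁far
  obtain ⟨γ₃, hγ₃c, hγ₃0, hγ₃mem, hγ₃R, hγ₃1⟩ := QuadCrossing.exists_restrict_until_dist_ge hγ₂c h0 h1
  have hγ₃pts : ∀ t ∈ Icc (0 : ℝ) 1, ∃ v ∈ Icc (0 : ℝ) 1, γ₃ t = g v ∧ r₁ ≤ dist (g v) xb := by
    intro t ht
    obtain ⟨u, hu, hu'⟩ := hγ₃mem t ht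
    obtain ⟨hw1, hw2⟩ := hγ₂maps u hu
    set w : ℝ := u₀ + u * (1 - u₀) with hw
    have hwI : w ∈ Icc (0 : ℝ) 1 := ⟨hu₀.1.le.trans hw1, hw2⟩
    obtain ⟨hv1, hv2⟩ := hγ'maps w hwI
    refine ⟨0 + w * (t₁ - 0), ⟨hv1, hv2.trans ht₁.2⟩, by rw [← hu'], ?_⟩
    show r₁ ≤ dist (γ' w) xb
    rcases hw1.eq_or_lt with h' | h'
    · rw [← h', hu₀eq]
    · exact (hu₀after w hwI h').le
  -- Step 10: freshness — arm points are off `M` and on no revealed edge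
  have hgv_out : ∀ v ∈ Icc (0 : ℝ) 1, r₁ ≤ dist (g v) xb → g v ∉ Mreg := by
    intro v hv hfarv
    rcases hv.1.eq_or_lt with h' | h'
    · exfalso; rw [← h'] at hfarv; linarith [hδ]
    · exact hgout v ⟨h', hv.2⟩
  have hfresh : ∀ v ∈ Icc (0 : ℝ) 1, r₁ ≤ dist (g v) xb →
      g v ∈ openEdgeUnion Φ.δ (ω \ S) := by
    intro v hv hfarv
    have hzM : g v ∉ Mreg := hgv_out v hv hfarv
    obtain ⟨a, b', hab, hωab, hseg⟩ := mem_openEdgeUnion_iff.1 (hgO v)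
    refine mem_openEdgeUnion_iff.2 ⟨a, b', hab, ⟨hωab, fun hSab => ?_⟩, hseg⟩
    -- a revealed open edge: its piece lies in `d ⊆ M`, and is nonempty
    have hpiece : Q'.piece Φ.δ (a, b') ⊆ d :=
      QuadCrossing.Quad.piece_subset_of_mem_revealedB_of_mem rfl hab hSab hωab
    obtain ⟨w, hw⟩ : (Q'.piece Φ.δ (a, b')).Nonempty := by
      obtain ⟨a'', b'', -, heq, w, hw, -⟩ := hSab
      have : Q'.piece Φ.δ (a'', b'') = Q'.piece Φ.δ (a, b') := by
        rcases Sym2.eq_iff.1 heq.symm with ⟨h₁, h₂⟩ | ⟨h₁, h₂⟩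
        · rw [h₁, h₂]
        · rw [h₁, h₂]; exact QuadCrossing.Quad.piece_swap (a, b')
      exact ⟨w, this ▸ hw⟩
    have hwM : w ∈ Mreg := hdM (hpiece hw)
    -- the sub-segment from `w` to `g v` lies in `[Q]` (tameness of the big quad)
    have hwQ : w ∈ Q.carrier := hcar hw.2
    have hsub : segment ℝ w (g v) ⊆ segment ℝ (meshPoint Φ.δ a) (meshPoint Φ.δ b') ∩ Q.carrier :=
      segment_subset_of_isPreconnected_subset_segment (htame a b' hab) inter_subset_left
        ⟨hw.1, hwQ⟩ ⟨hseg, hgQ v⟩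
    -- it meets `W`, necessarily in `E`, within `2Kρ` of `x♭`; but its points are within `2δ'` of `g v`
    by_cases hmeet : ∃ s, (segPath (g v) w) s ∈ W
    · obtain ⟨s, hs⟩ := hmeet
      have hsseg : (segPath (g v) w) s ∈ segment ℝ w (g v) := by
        rw [segment_symm, ← range_segPath (g v) w]; exact ⟨s, rfl⟩
      obtain ⟨hsedge, -⟩ := hsub hsseg
      have hsO : (segPath (g v) w) s ∈ openEdgeUnion Φ.δ ω :=
        mem_openEdgeUnion_iff.2 ⟨a, b', hab, hωab, hsedge⟩
      have hsE : (segPath (g v) w) s ∈ E := hWO _ hs hsO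
      have h1 := hEx _ hsE
      have h2 : dist (g v) ((segPath (g v) w) s) ≤ 2 * Φ.δ := by
        have ha1 := dist_meshPoint_le_of_mem_segment hδ hab hseg
        have ha2 := dist_meshPoint_le_of_mem_segment hδ hab hsedge
        linarith [dist_triangle (g v) (meshPoint Φ.δ a) ((segPath (g v) w) s),
          dist_comm (meshPoint Φ.δ a) (g v)]
      have : dist (g v) xb ≤ 2 * ρ + 2 * Φ.δ := by
        linarith [dist_triangle (g v) ((segPath (g v) w) s) xb]
      rw [hr₁] at hfarv
      linarith [hδ]
    · push Not at hmeet
      exact hzM (QuadCrossing.Quad.mem_below_of_path hwM (hgQ v) (segPath (g v) w)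
        (by rw [range_segPath, segment_symm]; exact fun z hz => (hsub hz).2) hmeet)
  -- Step 11: conclusion
  have hγ₃O : ∀ t ∈ Icc (0 : ℝ) 1, γ₃ t ∈ openEdgeUnion Φ.δ (ω \ S) := fun t ht => by
    obtain ⟨v, hv, hveq, hvfar⟩ := hγ₃pts t ht
    rw [hveq]; exact hfresh v hv hvfar
  have h0' : dist (γ₃ 0) xb ≤ r₁ := by rw [hγ₃0, hγ₂0, hu₀eq]
  have hmem := mem_annulusOpenCrossing_of_path hδ xb hγ₃c hγ₃O h0' hγ₃R hγ₃1
  rw [mem_annulusOpenCrossingOff_iff]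
  have hr₁eq : r₁ + Φ.δ = 2 * ρ + 4 * Φ.δ := by rw [hr₁]; ring
  have hR₀eq : R₀ - Φ.δ = c₃ / 2 - 4 * ρ - Φ.δ := by rw [hR₀]
  rw [← hr₁eq, ← hR₀eq]
  exact hmem


variable {Φ} in
/-- **Decoupling over the bottom open cluster** (margin-internal junctions, no chord–arc): as
`Charts.measureReal_dual_far_le` with the key inclusion `Charts.mem_annulusOpenCrossingOff_of_dual'`.
[cite: SchrammSmirnov2011, proof of Lemma 6.1, case (3) via case (2), eq. (6.2)] -/
theorem Charts.measureReal_dual_far_le' (hΦ : Φ.Charts Q') (hb : Φ.b = 1) (hc : Φ.c = -1)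
    (hd : Φ.d = 1) (hG : ∀ t : I, Φ.G ⟨1, 2 * (t : ℝ) - 1⟩ = Q' (1, t))
    (hcar : Q'.carrier ⊆ Q.carrier) (h0 : Q'.side 0 = Q.side 0) (h1 : Q'.side 1 ⊆ Q.side 1)
    {ρ : ℝ} (hρ : 0 < ρ) (hρ0 : ρ < Q.sideDist 0)
    (hjoin' : ∀ x ∈ Q'.side 2, ∃ y ∈ Q.side 2, ∃ α : Path x y, range α ⊆ Q.carrier ∧
      Metric.diam (range α) ≤ ρ ∧ ∀ s : I, α s ∈ Q'.carrier → α s = x)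
    (htame : ∀ a b : Site 2, (zdGraph 2).Adj a b →
      IsPreconnected (segment ℝ (meshPoint Φ.δ a) (meshPoint Φ.δ b) ∩ Q.carrier))
    (htame' : ∀ p : Site 2 × Site 2, (zdGraph 2).Adj p.1 p.2 →
      IsPreconnected (Q'.piece Φ.δ p))
    {c₃ : ℝ} (hc₃ : 12 * ρ + 6 * Φ.δ < c₃) {η : ℝ} (hη0 : 0 ≤ η)
    (hη : ∀ x : ℂ, (bondPercolation (zdGraph 2) half).real
      (annulusOpenCrossing x Φ.δ (2 * ρ + 4 * Φ.δ) (c₃ / 2 - 4 * ρ - Φ.δ)) ≤ η) :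
    (bondPercolation (zdGraph 2) half).real
      {ω | (∃ β : ℝ → ℂ, ContinuousOn β (Icc 0 1) ∧ MapsTo β (Icc 0 1) Q'.carrier ∧ β 0 ∈ Q'.side 0 ∧
          β 1 ∈ Q'.side 2 ∧ ∀ t ∈ Icc (0 : ℝ) 1, β t ∉ openEdgeUnion Φ.δ ω) ∧
        (∃ Kset : Set ℂ, IsCompact Kset ∧ IsConnected Kset ∧ Kset ⊆ Q.carrier ∧
          Kset ⊆ openEdgeUnion Φ.δ ω ∧ (Kset ∩ Q.side 1).Nonempty ∧ (Kset ∩ Q.side 3).Nonempty) ∧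
        ∀ t ∈ Q.side 3, ∀ p : Path (Q'.dualWallPt Φ.δ ω) t, range p ⊆ Q.carrier →
          c₃ ≤ Metric.diam (range p)} ≤
      η * (bondPercolation (zdGraph 2) half).real
        {ω | ∃ β : ℝ → ℂ, ContinuousOn β (Icc 0 1) ∧ MapsTo β (Icc 0 1) Q'.carrier ∧ β 0 ∈ Q'.side 0 ∧
          β 1 ∈ Q'.side 2 ∧ ∀ t ∈ Icc (0 : ℝ) 1, β t ∉ openEdgeUnion Φ.δ ω} := by
  have hδ : 0 < Φ.δ := Φ.hδ
  set μ := bondPercolation (zdGraph 2) half with hμ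
  set B : Set (BondConfig (Site 2)) := {ω | ∃ β : ℝ → ℂ, ContinuousOn β (Icc 0 1) ∧
      MapsTo β (Icc 0 1) Q'.carrier ∧ β 0 ∈ Q'.side 0 ∧ β 1 ∈ Q'.side 2 ∧
      ∀ t ∈ Icc (0 : ℝ) 1, β t ∉ openEdgeUnion Φ.δ ω} with hB
  set Ev : Set (BondConfig (Site 2)) := {ω | (∃ β : ℝ → ℂ, ContinuousOn β (Icc 0 1) ∧
      MapsTo β (Icc 0 1) Q'.carrier ∧ β 0 ∈ Q'.side 0 ∧ β 1 ∈ Q'.side 2 ∧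
        ∀ t ∈ Icc (0 : ℝ) 1, β t ∉ openEdgeUnion Φ.δ ω) ∧
      (∃ Kset : Set ℂ, IsCompact Kset ∧ IsConnected Kset ∧ Kset ⊆ Q.carrier ∧
        Kset ⊆ openEdgeUnion Φ.δ ω ∧ (Kset ∩ Q.side 1).Nonempty ∧ (Kset ∩ Q.side 3).Nonempty) ∧
      ∀ t ∈ Q.side 3, ∀ p : Path (Q'.dualWallPt Φ.δ ω) t, range p ⊆ Q.carrier →
        c₃ ≤ Metric.diam (range p)} with hEv
  set 𝒟 : Set (Set ℂ) := {d | ∃ ω, Q'.bottomCluster Φ.δ ω = d ∧ ω ∈ B} with h𝒟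
  have h𝒟c : 𝒟.Countable :=
    ((QuadCrossing.Quad.finite_range_bottomCluster (Q := Q') hδ).subset
      (by rintro d ⟨ω, hω, -⟩; exact ⟨ω, hω⟩)).countable
  set A : Set ℂ → Set (BondConfig (Site 2)) := fun d => {ω | Q'.bottomCluster Φ.δ ω = d} with hA
  set F : Set ℂ → Set (BondConfig (Site 2)) := fun d =>
    annulusOpenCrossingOff (Q'.revealedB Φ.δ d) (Q'.dualWallPtOf d) Φ.δ (2 * ρ + 4 * Φ.δ)
      (c₃ / 2 - 4 * ρ - Φ.δ) with hF
  -- the key inclusion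
  have hkey : ∀ ω ∈ Ev, ω ∈ F (Q'.bottomCluster Φ.δ ω) := by
    rintro ω ⟨hdual, hKop, hfar⟩
    have := hΦ.mem_annulusOpenCrossingOff_of_dual' hb hc hd hG hcar h0 h1 hρ hρ0 hjoin' htame htame'
      hc₃ hfar hdual hKop
    show ω ∈ annulusOpenCrossingOff (Q'.revealedB Φ.δ (Q'.bottomCluster Φ.δ ω))
      (Q'.dualWallPtOf (Q'.bottomCluster Φ.δ ω)) Φ.δ (2 * ρ + 4 * Φ.δ) (c₃ / 2 - 4 * ρ - Φ.δ)
    rw [← QuadCrossing.Quad.dualWallPt_eq]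
    exact this
  -- decoupling over the values of the bottom cluster
  have hEsub : Ev ⊆ ⋃ d ∈ 𝒟, A d ∩ F d := fun ω hω =>
    mem_iUnion₂.2 ⟨Q'.bottomCluster Φ.δ ω, ⟨ω, rfl, hω.1⟩, rfl, hkey ω hω⟩
  have hUB : (⋃ d ∈ 𝒟, A d) ⊆ B := by
    intro ω' hω'
    obtain ⟨d, hd', hω'd⟩ := mem_iUnion₂.1 hω'
    obtain ⟨ω, hωd, ⟨β, hβc, hβQ, hβ0, hβ1, hβO⟩⟩ := hd'
    have hempty := QuadCrossing.Quad.bottomCluster_inter_side_three_eq_empty_of_dualPath hδ htame'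
      hβc hβQ hβ0 hβ1 hβO
    rw [hωd] at hempty
    have hω'eq : Q'.bottomCluster Φ.δ ω' = d := hω'd
    exact QuadCrossing.Quad.exists_dualPath_of_bottomCluster_inter_side_three_eq_empty hδ
      (by rw [hω'eq]; exact hempty)
  have hAmeas : ∀ d ∈ 𝒟, MeasurableSet (A d) := fun d _ =>
    QuadCrossing.Quad.measurableSet_bottomCluster_eq hδ d
  have hdisj : 𝒟.PairwiseDisjoint A := fun d _ d' _ hne =>
    disjoint_left.2 fun ω (h : Q'.bottomCluster Φ.δ ω = d) (h' : Q'.bottomCluster Φ.δ ω = d') =>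
      hne (h.symm.trans h')
  have hprod : ∀ d ∈ 𝒟, μ (A d ∩ F d) = μ (A d) * μ (F d) := fun d hd' =>
    bondPercolation_inter_of_disjoint _ _ disjoint_compl_right
      (QuadCrossing.Quad.determinedBy_bottomCluster_eq d)
      (determinedBy_annulusOpenCrossingOff _ _ _ _ _) (hAmeas d hd')
      (measurableSet_annulusOpenCrossingOff _ hδ _ _ _)
  have hFle : ∀ d ∈ 𝒟, μ (F d) ≤ ENNReal.ofReal η := fun d _ => by
    refine (measure_mono (annulusOpenCrossingOff_subset _ _ _ _ _)).trans ?_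
    rw [← ENNReal.ofReal_toReal (measure_ne_top μ _)]
    exact ENNReal.ofReal_le_ofReal (hη _)
  have hbound := measure_le_mul_of_forall_inter_eq_mul μ h𝒟c hEsub hAmeas hdisj hprod hFle
  have hEv' : μ Ev ≤ ENNReal.ofReal η * μ B := hbound.trans (by gcongr)
  show (μ Ev).toReal ≤ η * (μ B).toReal
  have := ENNReal.toReal_mono (ENNReal.mul_ne_top ENNReal.ofReal_ne_top (measure_ne_top μ B)) hEv'
  rwa [ENNReal.toReal_mul, ENNReal.toReal_ofReal hη0] at this


end Frame

end SSContinuity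


namespace QuadCrossing

variable {D : Set ℂ}

/-- **Schramm–Smirnov Lemma 6.1 (3), tame pairs, margin-internal junctions, single mesh.**  As
`measureReal_symmDiff_le_mul_of_isPerturbationThree_of_tame`, but: lattice tameness of `[Q]`
(segments) and `[Q']` (pieces) only at the working mesh `δ' < 2ρ`; no chord–arc hypothesis, instead at
every `x ∈ ∂₃Q'` a junction to `∂₃Q` of diameter `≤ ρ` inside `[Q]` meeting `[Q']` only at `x`; the cut
`ζ` as before.  Then `P(⊞_Q Δ ⊞_{Q'}) ≤ 2 (C ρ / d₀(Q))^α · P(dual crossing of rot Q')`.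
[cite: SchrammSmirnov2011, Lemma 6.1 (3) and its proof, p. 23, via (2), eq. (6.2)–(6.4)] -/
theorem measureReal_symmDiff_le_mul_of_isPerturbationThree_tame' :
    ∃ α C c : ℝ, 0 < α ∧ 0 < C ∧ 0 < c ∧
      ∀ (D : Set ℂ) (Q Q' : Quad D) (ρ δ' : ℝ), 0 < δ' → δ' < 2 * ρ → ρ ≤ c * Q.sideDist 0 →
        ρ < Q.sideDist 1 → Q.IsPerturbationThree Q' ρ →
        (∀ x ∈ Q'.side 3, ∃ y ∈ Q.side 3, ∃ α : Path x y, range α ⊆ Q.carrier ∧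
          Metric.diam (range α) ≤ ρ ∧ ∀ s : I, α s ∈ Q'.carrier → α s = x) →
        (∀ a b : Site 2, (zdGraph 2).Adj a b →
          IsPreconnected (segment ℝ (meshPoint δ' a) (meshPoint δ' b) ∩ Q.carrier)) →
        (∀ p : Site 2 × Site 2, (zdGraph 2).Adj p.1 p.2 → IsPreconnected (Q'.piece δ' p)) →
        (∃ ζ : ℝ, (∀ t : I, (t : ℝ) ≤ ζ → ∀ y ∈ Q.side 0, ∀ p : Path (Q'.rot (1, t)) y,
            range p ⊆ Q.carrier → Q.sideDist 0 / 4 ≤ Metric.diam (range p)) ∧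
          (∀ t : I, ζ ≤ (t : ℝ) → ∀ y ∈ Q.side 2, ∀ p : Path (Q'.rot (1, t)) y,
            range p ⊆ Q.carrier → Q.sideDist 0 / 4 ≤ Metric.diam (range p))) →
          (bondPercolation (zdGraph 2) half).real
              (symmDiff {ω | Q ∈ z2QuadConfig D δ' ω} {ω | Q' ∈ z2QuadConfig D δ' ω}) ≤
            2 * ((C * ρ) / Q.sideDist 0) ^ α *
              (bondPercolation (zdGraph 2) half).real
                {ω | ∃ β : ℝ → ℂ, ContinuousOn β (Icc 0 1) ∧ MapsTo β (Icc 0 1) Q'.carrier ∧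
                  β 0 ∈ Q'.side 1 ∧ β 1 ∈ Q'.side 3 ∧
                  ∀ t ∈ Icc (0 : ℝ) 1, β t ∉ openEdgeUnion δ' ω} := by
  obtain ⟨α, c₀, hα, hc₀, hRSW⟩ := annulusOpenCrossing_half_le_holds
  set C₁ : ℝ := 10 + 2 * c₀ with hC₁
  have hC₁pos : 0 < C₁ := by rw [hC₁]; linarith
  refine ⟨α, 16 * C₁, 1 / (200 * (C₁ + 1)), hα, by positivity, by positivity, ?_⟩
  intro D Q Q' ρ δ' hδ' hδ'ρ2 hρc hρ1 h3 hjoin3 htame htame' hcut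
  have hρ : 0 < ρ := by linarith
  set R := Q.rot with hRdef
  set R' := Q'.rot with hR'def
  have h2R : R.IsPerturbationTwo R' ρ := (Quad.isPerturbationThree_iff_rot Q Q' ρ).1 h3
  have h2R' := h2R
  obtain ⟨hcar, h0, h1, h3', hjoin⟩ := h2R
  set d := Q.sideDist 0 with hd_def
  have hdpos : 0 < d := Q.sideDist_pos 0
  have hdR : R.sideDist 1 = d := Q.rot_sideDist_one
  have hd0R : R.sideDist 0 = Q.sideDist 1 := Q.rot_sideDist_zero
  have hkρ : 0 < ρ := hρ
  -- the margin-internal junctions, read on the relabelled quads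
  have hjoinR : ∀ x ∈ R'.side 2, ∃ y ∈ R.side 2, ∃ α : Path x y, range α ⊆ R.carrier ∧
      Metric.diam (range α) ≤ ρ ∧ ∀ s : I, α s ∈ R'.carrier → α s = x := by
    intro x hx
    rw [hR'def, Quad.rot_side_two] at hx
    obtain ⟨y, hy, α, hαQ, hαd, hαint⟩ := hjoin3 x hx
    refine ⟨y, by rw [hRdef, Quad.rot_side_two]; exact hy, α, by rw [hRdef, Quad.rot_carrier]; exact hαQ,
      hαd, fun s hs => hαint s (by rw [hR'def, Quad.rot_carrier] at hs; exact hs)⟩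
  -- the regime
  have hρd : 200 * (C₁ + 1) * ρ ≤ d := by
    have := hρc
    rw [div_mul_eq_mul_div, one_mul, le_div_iff₀ (by positivity)] at this
    linarith
  have hCk : 0 ≤ C₁ * ρ := by positivity
  have hc₀k : 0 ≤ c₀ * ρ := by positivity
  have hk200 : 200 * ρ ≤ d := by linarith
  -- the frame of `R'` (mesh `δ'`)
  obtain ⟨Φ, hΦ, hΦδ, hΦa, hΦb, hΦc, hΦd, hG⟩ := R'.exists_frame_charts' hδ'
  have hδ'pos : 0 < Φ.δ := Φ.hδ
  have hδ'ρ : Φ.δ < 2 * ρ := by rw [hΦδ]; exact hδ'ρ2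
  have hδ'k : Φ.δ ≤ 2 * ρ := hδ'ρ.le
  have htameR : ∀ a b : Site 2, (zdGraph 2).Adj a b →
      IsPreconnected (segment ℝ (meshPoint Φ.δ a) (meshPoint Φ.δ b) ∩ R.carrier) := by
    rw [hΦδ, hRdef, Quad.rot_carrier]; exact htame
  have htameR' : ∀ p : Site 2 × Site 2, (zdGraph 2).Adj p.1 p.2 →
      IsPreconnected (R'.piece Φ.δ p) := fun p hp => by
    rw [hΦδ, hR'def, Quad.rot_piece]; exact htame' p hp
  have hΦT : Φ.flipFrame.Charts R'.flip := SSContinuity.Frame.Charts.flipFrame Φ hΦ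
  have hGT := Φ.flipFrame_chart (Q' := R') hG
  -- Step 1: the discrete events
  rw [← hΦδ]
  set μ := bondPercolation (zdGraph 2) half with hμ
  set A : Set (BondConfig (Site 2)) := {ω | Q ∈ z2QuadConfig D Φ.δ ω} with hA
  set B : Set (BondConfig (Site 2)) := {ω | Q' ∈ z2QuadConfig D Φ.δ ω} with hB
  set Bd : Set (BondConfig (Site 2)) := {ω | ∃ β : ℝ → ℂ, ContinuousOn β (Icc 0 1) ∧
      MapsTo β (Icc 0 1) R'.carrier ∧ β 0 ∈ R'.side 0 ∧ β 1 ∈ R'.side 2 ∧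
      ∀ t ∈ Icc (0 : ℝ) 1, β t ∉ openEdgeUnion Φ.δ ω} with hBd
  have hBdQ' : Bd = {ω | ∃ β : ℝ → ℂ, ContinuousOn β (Icc 0 1) ∧ MapsTo β (Icc 0 1) Q'.carrier ∧
      β 0 ∈ Q'.side 1 ∧ β 1 ∈ Q'.side 3 ∧ ∀ t ∈ Icc (0 : ℝ) 1, β t ∉ openEdgeUnion Φ.δ ω} := by
    simp only [hBd, hR'def, Quad.rot_carrier, Quad.rot_side_zero, Quad.rot_side_two]
  have hBA : B ⊆ A := fun ω hω => by
    rw [hB, mem_setOf_eq, mem_z2QuadConfig_iff_exists_isCrossing hδ'pos] at hω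
    obtain ⟨K₀, hK₀, hK₀O⟩ := hω
    rw [hA, mem_setOf_eq, mem_z2QuadConfig_iff_exists_isCrossing hδ'pos]
    obtain ⟨hcar3, h03, -, h23, -⟩ := h3
    exact ⟨K₀, Quad.IsCrossing.of_subquad hcar3 h03 h23 hK₀, hK₀O⟩
  -- the dual picture on the bad event
  set c₃ : ℝ := d / 4 with hc₃
  set Ea : Set (BondConfig (Site 2)) := {ω | (∃ β : ℝ → ℂ, ContinuousOn β (Icc 0 1) ∧
      MapsTo β (Icc 0 1) R'.carrier ∧ β 0 ∈ R'.side 0 ∧ β 1 ∈ R'.side 2 ∧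
        ∀ t ∈ Icc (0 : ℝ) 1, β t ∉ openEdgeUnion Φ.δ ω) ∧
      (∃ Kset : Set ℂ, IsCompact Kset ∧ IsConnected Kset ∧ Kset ⊆ R.carrier ∧
        Kset ⊆ openEdgeUnion Φ.δ ω ∧ (Kset ∩ R.side 1).Nonempty ∧ (Kset ∩ R.side 3).Nonempty) ∧
      ∀ t ∈ R.side 3, ∀ p : Path (R'.dualWallPt Φ.δ ω) t, range p ⊆ R.carrier →
        c₃ ≤ Metric.diam (range p)} with hEa
  set Eb : Set (BondConfig (Site 2)) := {ω | (∃ β : ℝ → ℂ, ContinuousOn β (Icc 0 1) ∧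
      MapsTo β (Icc 0 1) R'.flip.carrier ∧ β 0 ∈ R'.flip.side 0 ∧ β 1 ∈ R'.flip.side 2 ∧
        ∀ t ∈ Icc (0 : ℝ) 1, β t ∉ openEdgeUnion Φ.flipFrame.δ ω) ∧
      (∃ Kset : Set ℂ, IsCompact Kset ∧ IsConnected Kset ∧ Kset ⊆ R.flip.carrier ∧
        Kset ⊆ openEdgeUnion Φ.flipFrame.δ ω ∧ (Kset ∩ R.flip.side 1).Nonempty ∧
        (Kset ∩ R.flip.side 3).Nonempty) ∧
      ∀ t ∈ R.flip.side 3, ∀ p : Path (R'.flip.dualWallPt Φ.flipFrame.δ ω) t,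
        range p ⊆ R.flip.carrier → c₃ ≤ Metric.diam (range p)} with hEb
  obtain ⟨ζ, hcut₀, hcut₂⟩ := hcut
  -- Step 2: the dichotomy `A ∖ B ⊆ Ea ∪ Eb`
  have hsplit : symmDiff A B ⊆ Ea ∪ Eb := by
    intro ω hω
    have hωA : ω ∈ A := by
      rcases (Set.mem_symmDiff).1 hω with ⟨hωA, -⟩ | ⟨hωB, -⟩
      · exact hωA
      · exact hBA hωB
    have hωB : ω ∉ B := by
      rcases (Set.mem_symmDiff).1 hω with ⟨-, hnB⟩ | ⟨hωB, hnA⟩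
      · exact hnB
      · exact absurd (hBA hωB) hnA
    rw [hA, mem_setOf_eq, mem_z2QuadConfig_iff_exists_isCrossing hδ'pos] at hωA
    rw [hB, mem_setOf_eq, mem_z2QuadConfig_iff_exists_isCrossing hδ'pos] at hωB
    obtain ⟨⟨β, hβc, hβQ, hβ0, hβ1, hβO⟩, hnodual⟩ :=
      Quad.crossed_and_not_crossed_subset_dual_rot Q Q' hδ'pos hωA hωB
    have hβO' : ∀ t ∈ Icc (0 : ℝ) 1, β t ∉ openEdgeUnion Φ.δ ω := fun t ht => (hβO t ht).1
    have hdual : ∃ β : ℝ → ℂ, ContinuousOn β (Icc 0 1) ∧ MapsTo β (Icc 0 1) R'.carrier ∧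
        β 0 ∈ R'.side 0 ∧ β 1 ∈ R'.side 2 ∧ ∀ t ∈ Icc (0 : ℝ) 1, β t ∉ openEdgeUnion Φ.δ ω :=
      ⟨β, hβc, hβQ, hβ0, hβ1, hβO'⟩
    have hKop := R.exists_openCrossing_transversal_of_not_exists_path hδ'pos (fun ⟨γ, hγc, hγm, hγ0, hγ1, hγO⟩ =>
      hnodual ⟨γ, hγc, hγm, hγ0, hγ1, fun t ht => (hγO t ht).1⟩)
    -- the two wall parameters
    set θC : ℝ := R'.topContact Φ.δ ω with hθC
    have horder : θC ≤ 1 - R'.flip.topContact Φ.δ ω :=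
      R'.topContact_le_one_sub_topContact_flip hδ'pos htameR' hdual
    by_cases hlow : θC ≤ ζ
    · left
      refine ⟨hdual, hKop, fun t ht p hp => ?_⟩
      have ht0 : t ∈ Q.side 0 := by rw [hRdef, Quad.rot_side_three] at ht; exact ht
      have hp' : range p ⊆ Q.carrier := by rw [hRdef, Quad.rot_carrier] at hp; exact hp
      have := hcut₀ ⟨θC, Quad.topContact_mem_Icc⟩ hlow t ht0 p hp'
      rw [hc₃]; exact this
    · right
      push Not at hlow
      refine ⟨?_, ?_, fun t ht p hp => ?_⟩
      · obtain ⟨β', hβ'c, hβ'Q, hβ'0, hβ'1, hβ'O⟩ := hdual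
        exact ⟨β', hβ'c, by rw [Quad.flip_carrier]; exact hβ'Q, by rw [Quad.flip_side_zero]; exact hβ'0,
          by rw [Quad.flip_side_two]; exact hβ'1, hβ'O⟩
      · obtain ⟨Kset, hKc, hKconn, hKQ, hKO, hK1, hK3⟩ := hKop
        exact ⟨Kset, hKc, hKconn, by rw [Quad.flip_carrier]; exact hKQ, hKO,
          by rw [Quad.flip_side_one]; exact hK3, by rw [Quad.flip_side_three]; exact hK1⟩
      · -- the flipped wall point `R'(1, σ θCf)` with `σ θCf ≥ θC > ζ`: far from `∂₂Q`
        set θCf : ℝ := R'.flip.topContact Φ.flipFrame.δ ω with hθCf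
        have hθCfI : θCf ∈ Icc (0 : ℝ) 1 := Quad.topContact_mem_Icc
        have hδT : Φ.flipFrame.δ = Φ.δ := by simp
        have hwall : R'.flip.dualWallPt Φ.flipFrame.δ ω = R' (1, σ ⟨θCf, hθCfI⟩) := by
          show R'.flip (1, ⟨R'.flip.topContact Φ.flipFrame.δ ω, _⟩) = _
          rw [Quad.flip_apply]
        have hζ : ζ ≤ ((σ ⟨θCf, hθCfI⟩ : I) : ℝ) := by
          rw [unitInterval.coe_symm_eq]
          show ζ ≤ 1 - θCf
          rw [hθCf, hδT]; linarith
        have ht2 : t ∈ Q.side 2 := by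
          rw [Quad.flip_side_three, hRdef, Quad.rot_side_one] at ht; exact ht
        have hp' : range p ⊆ Q.carrier := by
          rw [Quad.flip_carrier, hRdef, Quad.rot_carrier] at hp; exact hp
        have := hcut₂ (σ ⟨θCf, hθCfI⟩) hζ t ht2 (p.cast hwall.symm rfl) (by rw [Path.cast_coe]; exact hp')
        rw [Path.cast_coe] at this
        rw [hc₃]; exact this
  -- Step 3: the radii and the RSW bound
  set r' : ℝ := max (2 * ρ + 4 * Φ.δ) (c₀ * Φ.δ) with hr'
  set Rout : ℝ := c₃ / 2 - 4 * ρ - Φ.δ with hRout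
  have hc₀δ : c₀ * Φ.δ ≤ c₀ * (2 * ρ) := mul_le_mul_of_nonneg_left hδ'k hc₀.le
  have hr'le : r' ≤ C₁ * ρ := by
    rw [hr', max_le_iff, hC₁]
    constructor
    · linarith
    · linarith
  have hr'0 : 0 < r' := lt_of_lt_of_le (by positivity) (le_max_left _ _)
  have hRge : d / 16 ≤ Rout := by rw [hRout, hc₃]; linarith
  have hc₃big : 12 * ρ + 6 * Φ.δ < c₃ := by rw [hc₃]; linarith
  have h2r : 2 * r' ≤ Rout := by linarith
  set ηb : ℝ := (r' / Rout) ^ α with hηb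
  have hηb0 : 0 ≤ ηb := Real.rpow_nonneg (div_nonneg hr'0.le (by linarith)) _
  have hRSW' : ∀ x : ℂ, μ.real (annulusOpenCrossing x Φ.δ (2 * ρ + 4 * Φ.δ) Rout) ≤ ηb := by
    intro x
    have hsub : annulusOpenCrossing x Φ.δ (2 * ρ + 4 * Φ.δ) Rout ⊆
        annulusOpenCrossing x Φ.δ r' Rout :=
      SSContinuity.annulusOpenCrossing_mono_left x Φ.δ (by rw [hr']; exact le_max_left _ _) Rout
    refine (measureReal_mono hsub (measure_ne_top _ _)).trans ?_
    exact hRSW x Φ.δ r' Rout hδ'pos (by rw [hr']; exact le_max_right _ _) h2r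
  -- Step 4: the two decoupling bounds
  have hEa : μ.real Ea ≤ ηb * μ.real Bd := by
    have := SSContinuity.Frame.Charts.measureReal_dual_far_le' hΦ hΦb hΦc hΦd hG hcar h0 h1 hρ
      (by rw [hd0R]; exact hρ1) hjoinR htameR htameR' hc₃big hηb0 hRSW'
    exact this
  have hEb : μ.real Eb ≤ ηb * μ.real Bd := by
    obtain ⟨hcarT, h0T, h1T, h3T, -⟩ := Quad.IsPerturbationTwo.flip h2R'
    have hjoinT := Quad.marginJoin_flip hjoinR
    have hρ0T : ρ < R.flip.sideDist 0 := by rw [Quad.flip_sideDist_zero, hd0R]; exact hρ1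
    have htameT : ∀ a b : Site 2, (zdGraph 2).Adj a b →
        IsPreconnected (segment ℝ (meshPoint Φ.flipFrame.δ a) (meshPoint Φ.flipFrame.δ b) ∩
          R.flip.carrier) := by
      rw [Quad.flip_carrier]; exact htameR
    have htameT' : ∀ p : Site 2 × Site 2, (zdGraph 2).Adj p.1 p.2 →
        IsPreconnected (R'.flip.piece Φ.flipFrame.δ p) := fun p hp => by
      rw [Quad.flip_piece]; exact htameR' p hp
    have hc₃T : 12 * ρ + 6 * Φ.flipFrame.δ < c₃ := hc₃big
    have hRSWT : ∀ x : ℂ, μ.real (annulusOpenCrossing x Φ.flipFrame.δ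
        (2 * ρ + 4 * Φ.flipFrame.δ) (c₃ / 2 - 4 * ρ - Φ.flipFrame.δ)) ≤ ηb := hRSW'
    have := SSContinuity.Frame.Charts.measureReal_dual_far_le' hΦT (by simp [hΦb]) (by simp [hΦd])
      (by simp [hΦc]) hGT hcarT h0T h1T hρ hρ0T hjoinT htameT htameT'
      hc₃T hηb0 hRSWT
    have hBT : {ω | ∃ β : ℝ → ℂ, ContinuousOn β (Icc 0 1) ∧ MapsTo β (Icc 0 1) R'.flip.carrier ∧
        β 0 ∈ R'.flip.side 0 ∧ β 1 ∈ R'.flip.side 2 ∧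
        ∀ t ∈ Icc (0 : ℝ) 1, β t ∉ openEdgeUnion Φ.flipFrame.δ ω} = Bd := by
      simp only [hBd, Quad.flip_carrier, Quad.flip_side_zero, Quad.flip_side_two,
        SSContinuity.Frame.flipFrame_δ]
    rw [hBT] at this
    exact this
  -- Step 5: assemble
  have hmono : μ.real (symmDiff A B) ≤ μ.real (Ea ∪ Eb) :=
    measureReal_mono hsplit (measure_ne_top _ _)
  refine hmono.trans ((measureReal_union_le Ea Eb).trans ?_)
  rw [← hBdQ']
  have hbase : r' / Rout ≤ 16 * C₁ * ρ / d := by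
    rw [div_le_div_iff₀ (by linarith) hdpos]
    calc r' * d ≤ C₁ * ρ * d := mul_le_mul_of_nonneg_right hr'le hdpos.le
      _ = 16 * C₁ * ρ * (d / 16) := by ring
      _ ≤ 16 * C₁ * ρ * Rout := by
          apply mul_le_mul_of_nonneg_left hRge; positivity
  have hpow : ηb ≤ (16 * C₁ * ρ / d) ^ α :=
    Real.rpow_le_rpow (div_nonneg hr'0.le (by linarith)) hbase hα.le
  have hB0 : 0 ≤ μ.real Bd := measureReal_nonneg
  have : ηb * μ.real Bd ≤ (16 * C₁ * ρ / d) ^ α * μ.real Bd :=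
    mul_le_mul_of_nonneg_right hpow hB0
  linarith

end QuadCrossing

end Literature.Probability.Percolation

end
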